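import Summits.CriticalPhenomena.CardyFormulaZ2.Theorems.CardySusyWardDiscretisationFamilyExistsLattice
import Mathlib.Analysis.Complex.Circle
import Mathlib.Analysis.Complex.Isometry
import HarnessLib

/-!
# The concrete lattice isometries — helper for `DiscretisationFamilyExists` (stmt-CriticalPhenomena-9644)

The four lattice isometries used to bring a leg into standard orientation, each packaged as an
existence statement `∃ g gf G π, …` with the four structural properties consumed by the transport
(`…ExistsTransportA/B/C`: mesh points, corners, unit directions under `g⁻¹`, rotation/reflection
type of `π`) and the formulas for `G`, `g`, `gf`:
the quarter turns `z ↦ I z`, `z ↦ -z`, `z ↦ -I z` and the reflection `z ↦ -z̄` in the imaginary axis.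
-/

noncomputable section

open Set Metric Complex
open Literature.Probability.LatticeModels Literature.Probability.Percolation
  Literature.Probability.LatticeModels.DiscreteDobrushin

namespace Summit.CriticalPhenomena.CardyFormulaZ2.Theorems.DiscretisationFamilyExists

/-- Corners of a face in coordinates. [folklore] -/
theorem isCorner_iff_coord {x f : Site 2} :
    IsCorner x f ↔ (x 0 = f 0 ∨ x 0 = f 0 + 1) ∧ (x 1 = f 1 ∨ x 1 = f 1 + 1) := by
  constructor
  · intro h; exact ⟨h 0, h 1⟩
  · rintro ⟨h0, h1⟩ i; fin_cases i <;> assumption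

/-- **The quarter turn `z ↦ I z`** as a lattice isometry: `g x = (-x₁, x₀)`, faces
`f ↦ (-f₁ - 1, f₀)`, `π m = m + 3`. [folklore] -/
theorem exists_latticeIso_rotI (δ : ℝ) :
    ∃ (g gf : Site 2 ≃ Site 2) (G : ℂ ≃ₗᵢ[ℝ] ℂ) (π : Fin 4 → Fin 4),
      (∀ x, meshPoint δ (g x) = G (meshPoint δ x)) ∧
      (∀ x f, IsCorner (g x) (gf f) ↔ IsCorner x f) ∧
      (∀ x m, g.symm (x + cornerUnit m) = g.symm x + cornerUnit (π m)) ∧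
      (∀ m, cornerUnit (π (m + 1)) = cornerUnit (π m + 1) ∨ cornerUnit (π (m + 1)) = -cornerUnit (π m + 1)) ∧
      (∀ z, G z = I * z) ∧ (∀ x, g x = ![-(x 1), x 0]) ∧ (∀ f, gf f = ![-(f 1) - 1, f 0]) := by
  refine ⟨⟨fun x => ![-(x 1), x 0], fun x => ![x 1, -(x 0)], fun x => ?_, fun x => ?_⟩,
    ⟨fun f => ![-(f 1) - 1, f 0], fun f => ![f 1, -(f 0) - 1], fun f => ?_, fun f => ?_⟩,
    rotation (⟨I, by simp [Submonoid.unitSphere]⟩ : Circle), fun m => m + 3,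
    fun x => ?_, fun x f => ?_, fun x m => ?_, fun m => Or.inl (by rw [add_right_comm]), fun z => ?_, fun x => rfl, fun f => rfl⟩
  · funext i; fin_cases i <;> simp
  · funext i; fin_cases i <;> simp
  · funext i; fin_cases i <;> simp
  · funext i; fin_cases i <;> simp
  · rw [rotation_apply]
    apply Complex.ext <;> simp [meshPoint_re, meshPoint_im]
  · simp only [Equiv.coe_fn_mk, isCorner_iff_coord, Matrix.cons_val_zero, Matrix.cons_val_one]
    omega
  · simp only [Equiv.coe_fn_symm_mk]
    funext i; fin_cases m <;> fin_cases i <;> simp [cornerUnit] <;> ring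
  · rw [rotation_apply]

/-- **The half turn `z ↦ -z`** as a lattice isometry: `g x = -x`, faces `f ↦ (-f₀ - 1, -f₁ - 1)`,
`π m = m + 2`. [folklore] -/
theorem exists_latticeIso_neg (δ : ℝ) :
    ∃ (g gf : Site 2 ≃ Site 2) (G : ℂ ≃ₗᵢ[ℝ] ℂ) (π : Fin 4 → Fin 4),
      (∀ x, meshPoint δ (g x) = G (meshPoint δ x)) ∧
      (∀ x f, IsCorner (g x) (gf f) ↔ IsCorner x f) ∧
      (∀ x m, g.symm (x + cornerUnit m) = g.symm x + cornerUnit (π m)) ∧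
      (∀ m, cornerUnit (π (m + 1)) = cornerUnit (π m + 1) ∨ cornerUnit (π (m + 1)) = -cornerUnit (π m + 1)) ∧
      (∀ z, G z = -z) ∧ (∀ x, g x = ![-(x 0), -(x 1)]) ∧ (∀ f, gf f = ![-(f 0) - 1, -(f 1) - 1]) := by
  refine ⟨⟨fun x => ![-(x 0), -(x 1)], fun x => ![-(x 0), -(x 1)], fun x => ?_, fun x => ?_⟩,
    ⟨fun f => ![-(f 0) - 1, -(f 1) - 1], fun f => ![-(f 0) - 1, -(f 1) - 1], fun f => ?_, fun f => ?_⟩,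
    LinearIsometryEquiv.neg ℝ, fun m => m + 2,
    fun x => ?_, fun x f => ?_, fun x m => ?_, fun m => Or.inl (by rw [add_right_comm]), fun z => rfl, fun x => rfl, fun f => rfl⟩
  · funext i; fin_cases i <;> simp
  · funext i; fin_cases i <;> simp
  · funext i; fin_cases i <;> simp
  · funext i; fin_cases i <;> simp
  · simp only [LinearIsometryEquiv.coe_neg]
    apply Complex.ext <;> simp [meshPoint_re, meshPoint_im]
  · simp only [Equiv.coe_fn_mk, isCorner_iff_coord, Matrix.cons_val_zero, Matrix.cons_val_one]
    omega
  · simp only [Equiv.coe_fn_symm_mk]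
    funext i; fin_cases m <;> fin_cases i <;> simp [cornerUnit] <;> ring

/-- **The quarter turn `z ↦ -I z`** as a lattice isometry: `g x = (x₁, -x₀)`, faces
`f ↦ (f₁, -f₀ - 1)`, `π m = m + 1`. [folklore] -/
theorem exists_latticeIso_rotNegI (δ : ℝ) :
    ∃ (g gf : Site 2 ≃ Site 2) (G : ℂ ≃ₗᵢ[ℝ] ℂ) (π : Fin 4 → Fin 4),
      (∀ x, meshPoint δ (g x) = G (meshPoint δ x)) ∧
      (∀ x f, IsCorner (g x) (gf f) ↔ IsCorner x f) ∧
      (∀ x m, g.symm (x + cornerUnit m) = g.symm x + cornerUnit (π m)) ∧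
      (∀ m, cornerUnit (π (m + 1)) = cornerUnit (π m + 1) ∨ cornerUnit (π (m + 1)) = -cornerUnit (π m + 1)) ∧
      (∀ z, G z = -I * z) ∧ (∀ x, g x = ![x 1, -(x 0)]) ∧ (∀ f, gf f = ![f 1, -(f 0) - 1]) := by
  refine ⟨⟨fun x => ![x 1, -(x 0)], fun x => ![-(x 1), x 0], fun x => ?_, fun x => ?_⟩,
    ⟨fun f => ![f 1, -(f 0) - 1], fun f => ![-(f 1) - 1, f 0], fun f => ?_, fun f => ?_⟩,
    rotation (⟨-I, by simp [Submonoid.unitSphere]⟩ : Circle), fun m => m + 1,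
    fun x => ?_, fun x f => ?_, fun x m => ?_, fun m => Or.inl rfl, fun z => ?_, fun x => rfl, fun f => rfl⟩
  · funext i; fin_cases i <;> simp
  · funext i; fin_cases i <;> simp
  · funext i; fin_cases i <;> simp
  · funext i; fin_cases i <;> simp
  · rw [rotation_apply]
    apply Complex.ext <;> simp [meshPoint_re, meshPoint_im]
  · simp only [Equiv.coe_fn_mk, isCorner_iff_coord, Matrix.cons_val_zero, Matrix.cons_val_one]
    omega
  · simp only [Equiv.coe_fn_symm_mk]
    funext i; fin_cases m <;> fin_cases i <;> simp [cornerUnit] <;> ring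
  · rw [rotation_apply]

/-- **The reflection `z ↦ -z̄`** in the imaginary axis as a lattice isometry: `g x = (-x₀, x₁)`,
faces `f ↦ (-f₀ - 1, f₁)`, `π m = 2 - m`. [folklore] -/
theorem exists_latticeIso_refl (δ : ℝ) :
    ∃ (g gf : Site 2 ≃ Site 2) (G : ℂ ≃ₗᵢ[ℝ] ℂ) (π : Fin 4 → Fin 4),
      (∀ x, meshPoint δ (g x) = G (meshPoint δ x)) ∧
      (∀ x f, IsCorner (g x) (gf f) ↔ IsCorner x f) ∧
      (∀ x m, g.symm (x + cornerUnit m) = g.symm x + cornerUnit (π m)) ∧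
      (∀ m, cornerUnit (π (m + 1)) = cornerUnit (π m + 1) ∨ cornerUnit (π (m + 1)) = -cornerUnit (π m + 1)) ∧
      (∀ z, G z = -(starRingEnd ℂ) z) ∧ (∀ x, g x = ![-(x 0), x 1]) ∧ (∀ f, gf f = ![-(f 0) - 1, f 1]) := by
  refine ⟨⟨fun x => ![-(x 0), x 1], fun x => ![-(x 0), x 1], fun x => ?_, fun x => ?_⟩,
    ⟨fun f => ![-(f 0) - 1, f 1], fun f => ![-(f 0) - 1, f 1], fun f => ?_, fun f => ?_⟩,
    Complex.conjLIE.trans (LinearIsometryEquiv.neg ℝ), fun m => 2 - m,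
    fun x => ?_, fun x f => ?_, fun x m => ?_, fun m => ?_, fun z => by simp, fun x => rfl, fun f => rfl⟩
  · funext i; fin_cases i <;> simp
  · funext i; fin_cases i <;> simp
  · funext i; fin_cases i <;> simp
  · funext i; fin_cases i <;> simp
  · simp only [LinearIsometryEquiv.trans_apply, LinearIsometryEquiv.coe_neg, Complex.conjLIE_apply]
    apply Complex.ext <;> simp [meshPoint_re, meshPoint_im]
  · simp only [Equiv.coe_fn_mk, isCorner_iff_coord, Matrix.cons_val_zero, Matrix.cons_val_one]
    omega
  · simp only [Equiv.coe_fn_symm_mk]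
    funext i; fin_cases m <;> fin_cases i <;> simp [cornerUnit] <;> ring
  · right; fin_cases m <;> decide

end Summit.CriticalPhenomena.CardyFormulaZ2.Theorems.DiscretisationFamilyExists

end
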